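import Literature.AlgebraicGeometry.Motives.AbelianVarietyTateModuleFiniteBaseChange
import Literature.AlgebraicGeometry.Motives.AbelianVarietyEndGaloisDescent
import Literature.AlgebraicGeometry.Motives.FaltingsAbelianProofs
import Literature.NumberTheory.DiophantineGeometry.AVIsogenyTateHoldsProofs
import Mathlib.LinearAlgebra.TensorProduct.Pi
import Mathlib.RingTheory.Flat.Basic
import HarnessLib

/-!
# Faltings' isogeny theorem descends along a finite Galois extension of the ground field
# («wir dürfen `K` durch eine endliche Erweiterung ersetzen», [Faltings 1983, §5, proof of Satz 4])

Topic `Literature/AlgebraicGeometry/Motives`.  THEOREMS ONLY, all proved (no definition, no named fact, no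
instance).  Cell `hodgecm-mathlib` (D-0151), fan A / T5, row VI-1: the base-change half of the planned stub
`stub_desc` of `Cruxes/HLiu418/Lines/faltings_isogeny.lean` v2 (brick 2; brick 1 is
`Motives/AbelianVarietyTateModuleFiniteBaseChange`, whose `e : T_ℓ(P) ≃ T_ℓ(P_E)` is used throughout).

For number fields `K ⊆ E` with `E/K` NORMAL and an abelian variety `P` over `K`: if the Tate map
`ℤ_ℓ ⊗ End_E(P_E) → End_{Γ_E}(T_ℓ P_E)` is bijective, then so is `ℤ_ℓ ⊗ End_K(P) → End_{Γ_K}(T_ℓ P)`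
(`faltings_tate_bijective_of_baseChange_end`); hence Faltings' theorem for all abelian varieties over `E` implies
it for all pairs over `K` (`faltings_tate_bijective_of_forall_baseChange`, through `A ⊞ B` and ★
`faltings_tate_bijective_of_end_biprod`) — the reduction with which the proof of [Faltings 1983, Satz 4] begins
(there: to reach semistable reduction).  The print argument `End_K(P) ⊗ ℤ_ℓ = (End_E(P_E) ⊗ ℤ_ℓ)^{Gal(E/K)}`,
`End_{Γ_K}(T_ℓ) = End_{Γ_E}(T_ℓ)^{Gal(E/K)}` is formalised as:

* §1 (commutative algebra) `exists_lTensor_eq_of_forall_lTensor_eq` — for a flat `R`-module `T`, `f : N' → N`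
  and finitely many endomorphisms `φᵢ` of `N` with `range f = {n | ∀ i, φᵢ n = n}`, every element of `T ⊗ N`
  fixed by all `1 ⊗ φᵢ` comes from `T ⊗ N'` (Mathlib `Module.Flat.lTensor_exact`, `TensorProduct.piRight`).
* §2 (the Galois twist on `Ē`-points and on `T_ℓ`) for `σ' ∈ Aut(Ē/K)` restricting to `τ ∈ Aut(E/K)`:
  `(σ' • x)_E = Spec σ' ≫ x_E ≫ gal τ` (`pointsEquivOfTower_smul_left`), **`(τ • r)(x) = σ' • r(σ'⁻¹ • x)`** on
  `P(Ē) ≃ P_E(Ē)` (`pointsEquivOfTower_symm_comp_galConj`; the `Ē`-points forms of ★ `pointsEquiv_smul_left` /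
  `pointsEnd_galConj`), and, for `g ∈ Γ_K` compatible with `σ'`,
  **`T_ℓ(τ • r) (e (g • e⁻¹ b)) = e (g • e⁻¹ (T_ℓ(r) b))`** (`tateModuleMap_galConj_apply`).
* §3 the descent: the preimage of `e ∘ g ∘ e⁻¹` (`g` `Γ_K`-equivariant) under the injective (★
  `faltingsTateMap_injective_holds`) Tate map over `E` is `Gal(E/K)`-fixed
  (`lTensor_galConj_eq_of_faltingsTateMap_eq`); Galois descent of endomorphisms ★
  `exists_end_of_baseChange_eq_of_forall_smul_eq` / `galConj_baseChange` (`K` perfect, `E/K` normal) feeds §1;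
  the Tate-map square of brick 1 (`toLinearMap_faltingsTateMap_baseChange`) finishes.

## References

* [Faltings1983Endlichkeit] G. Faltings, *Endlichkeitssätze für abelsche Varietäten über Zahlkörpern*, Invent.
  Math. 73 (1983), §5, proof of Satz 4, p. 360 (first sentence: reduction to a finite extension of `K`).
* [Milne1986AbelianVarieties] J. S. Milne, *Abelian Varieties*, in Cornell–Silverman (1986), §16 and proof of
  Thm. 12.5 (Galois descent of homomorphisms; `Hom_K = Hom_{K̄}^{Gal}`).
* [GortzWedhorn2020] U. Görtz, T. Wedhorn, *Algebraic Geometry I*, 2nd ed., (14.20) (Galois action on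
  `X_L(S)`), Thm. 14.86.
-/

noncomputable section

open CategoryTheory CategoryTheory.Limits Function AlgebraicGeometry
open Literature.NumberTheory.EllipticCurves (TateModule)
open scoped TensorProduct

universe u

namespace Literature.AlgebraicGeometry.Motives

/-! ## §1 Fixed points of finitely many endomorphisms commute with flat base change -/

section FlatFixed

variable {R : Type*} [CommRing R] (T : Type*) [AddCommGroup T] [Module R T] [Module.Flat R T]
  {N' N : Type*} [AddCommGroup N'] [Module R N'] [AddCommGroup N] [Module R N] {ι : Type*}

omit [Module.Flat R T] in
/-- Components of `T ⊗ (N → ∏ᵢ N)` under `T ⊗ ∏ᵢ N ≃ ∏ᵢ (T ⊗ N)` (Mathlib `TensorProduct.piRight`): the `i`-th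
component of `(1 ⊗ δ) z` is `(1 ⊗ δᵢ) z`. [folklore] -/
private theorem piRight_lTensor_pi_apply [Fintype ι] [DecidableEq ι] (δ : ι → (N →ₗ[R] N)) (z : T ⊗[R] N) (i : ι) :
    TensorProduct.piRight R R T (fun _ : ι ↦ N) ((LinearMap.pi δ).lTensor T z) i = (δ i).lTensor T z := by
  induction z using TensorProduct.induction_on with
  | zero => simp only [map_zero, Pi.zero_apply]
  | tmul t n => rfl
  | add a b ha hb => simp only [map_add, Pi.add_apply, ha, hb]

/-- **Invariants commute with flat base change.** Let `T` be a flat `R`-module, `f : N' → N` an `R`-linear map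
and `φᵢ` (`i ∈ ι`, finite) `R`-linear endomorphisms of `N` fixing `f(N')` pointwise and such that every common
fixed vector of the `φᵢ` lies in `f(N')` (so `N' → N → ∏ᵢ N`, `n ↦ (φᵢ n - n)ᵢ`, is exact). Then every
`x ∈ T ⊗_R N` with `(1 ⊗ φᵢ) x = x` for all `i` is of the form `(1 ⊗ f) y`, `y ∈ T ⊗_R N'` (exactness of
`T ⊗ -` on the sequence, Mathlib `Module.Flat.lTensor_exact`; e.g. `(ℤ_ℓ ⊗ M)^G = ℤ_ℓ ⊗ M^G` for a finite group
`G`). [cite: Milne1986AbelianVarieties, §16 (Galois descent) and proof of Thm. 12.5] -/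
theorem exists_lTensor_eq_of_forall_lTensor_eq [Finite ι] (f : N' →ₗ[R] N) (φ : ι → (N →ₗ[R] N))
    (hfix : ∀ i n', φ i (f n') = f n') (hdesc : ∀ n, (∀ i, φ i n = n) → n ∈ LinearMap.range f)
    (x : T ⊗[R] N) (hx : ∀ i, (φ i).lTensor T x = x) :
    ∃ y : T ⊗[R] N', f.lTensor T y = x := by
  classical
  cases nonempty_fintype ι
  let δ : N →ₗ[R] (ι → N) := LinearMap.pi fun i ↦ φ i - LinearMap.id
  have hexact : Function.Exact f δ := by
    refine fun n ↦ ⟨fun hn ↦ ?_, ?_⟩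
    · obtain ⟨n', hn'⟩ := hdesc n fun i ↦ sub_eq_zero.mp (by
        simpa only [δ, LinearMap.pi_apply, LinearMap.sub_apply, LinearMap.id_apply, Pi.zero_apply]
          using congr_fun hn i)
      exact ⟨n', hn'⟩
    · rintro ⟨n', rfl⟩
      funext i
      simp only [δ, LinearMap.pi_apply, LinearMap.sub_apply, LinearMap.id_apply, hfix, sub_self, Pi.zero_apply]
  have hx0 : δ.lTensor T x = 0 := by
    apply (TensorProduct.piRight R R T (fun _ : ι ↦ N)).injective
    rw [map_zero]
    funext i
    rw [piRight_lTensor_pi_apply, LinearMap.lTensor_sub, LinearMap.lTensor_id, LinearMap.sub_apply, hx i,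
      LinearMap.id_apply, sub_self, Pi.zero_apply]
  exact ((Module.Flat.lTensor_exact T hexact) x).mp hx0

end FlatFixed

namespace AbelianVariety

open scoped MonObj Obj

/-! ## §2 The Galois twist of an endomorphism of `P_E`, read on `Ē`-points and on `T_ℓ` -/

section GalConjPoints

open AlgPoints

variable {K : Type u} [Field K] (E : Type u) [Field E] [Algebra K E] (P : AbelianVariety K)
  (S : Type u) [Field S] [Algebra K S] [Algebra E S] [IsScalarTower K E S]

/-- A point in the image of `P(S) ≃ P_E(S)` lies over `Spec S → Spec E`. [cite: GortzWedhorn2020, Section (4.7)] -/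
@[reassoc]
theorem pointsEquivOfTower_apply_left_comp_snd (x : P.Points S) :
    (pointsEquivOfTower E P S x).left ≫ pullback.snd P.X.hom (bcSpec K E) =
      Spec.map (CommRingCat.ofHom (algebraMap E S)) :=
  Over.w (pointsEquivOfTower E P S x)

set_option backward.isDefEq.respectTransparency false in
/-- **Galois twists of `S`-points and the Galois automorphisms of `P_E`**: if `σ' ∈ Aut(S/K)` restricts to
`τ ∈ Aut(E/K)` (`σ' (x) = τ (x)` for `x ∈ E`), then on schemes `(σ' • x)_E = Spec σ' ≫ x_E ≫ gal τ`
(`gal τ = 1 × Spec τ⁻¹`; the `S`-points form of ★ `pointsEquiv_smul_left`).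
[cite: GortzWedhorn2020, Section (14.20) (Galois action on S-valued points of a base change)] -/
theorem pointsEquivOfTower_smul_left (σ' : S ≃ₐ[K] S) (τ : E ≃ₐ[K] E)
    (h : ∀ x : E, σ' (algebraMap E S x) = algebraMap E S (τ x)) (x : P.Points S) :
    (pointsEquivOfTower E P S (σ' • x)).left =
      specAut S σ' ≫ (pointsEquivOfTower E P S x).left ≫ P.gal E τ := by
  apply pullback.hom_ext
  · simp only [Category.assoc, gal_fst]
    rw [← bcFst_def, pointsEquivOfTower_apply_left_comp_bcFst, pointsEquivOfTower_apply_left_comp_bcFst,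
      AlgPoints.smul_left]
  · simp only [Category.assoc, gal_snd]
    rw [pointsEquivOfTower_apply_left_comp_snd, pointsEquivOfTower_apply_left_comp_snd_assoc, specAut,
      ← Spec.map_comp, ← Spec.map_comp, ← CommRingCat.ofHom_comp, ← CommRingCat.ofHom_comp]
    congr 2
    ext y
    change algebraMap E S y = σ' (algebraMap E S ((τ⁻¹ : E ≃ₐ[K] E) y))
    rw [h, ← AlgEquiv.mul_apply, mul_inv_cancel, AlgEquiv.one_apply]

set_option backward.isDefEq.respectTransparency false in
/-- **The Galois conjugate of an endomorphism acts by conjugation on `Ē`-points**: for `r ∈ End(P_E)` acting on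
`P(S)` through `P(S) ≃ P_E(S)` (`x ↦ (x_E ≫ r)` read back in `P(S)`), and `σ' ∈ Aut(S/K)` restricting to
`τ ∈ Aut(E/K)`: `(τ • r)(x) = σ' • r(σ'⁻¹ • x)` (the `S`-points form of ★ `pointsEnd_galConj`; `τ • r = galConj τ r`,
on schemes `gal τ⁻¹ ≫ r ≫ gal τ`, ★ `toSchemeHom_galConj`).
[cite: GortzWedhorn2020, Section (14.20) (Galois action on S-valued points of a base change)] [cite: Milne1986AbelianVarieties, §16] -/
theorem pointsEquivOfTower_symm_comp_galConj (σ' : S ≃ₐ[K] S) (τ : E ≃ₐ[K] E)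
    (h : ∀ x : E, σ' (algebraMap E S x) = algebraMap E S (τ x))
    (r : P.baseChange E ⟶ P.baseChange E) (x : P.Points S) :
    (pointsEquivOfTower E P S).symm (pointsEquivOfTower E P S x ≫ (P.galConj E τ r).hom.hom.hom) =
      σ' • (pointsEquivOfTower E P S).symm (pointsEquivOfTower E P S (σ'⁻¹ • x) ≫ r.hom.hom.hom) := by
  have h' : ∀ y : E, σ'⁻¹ (algebraMap E S y) = algebraMap E S ((τ⁻¹ : E ≃ₐ[K] E) y) := fun y ↦ by
    apply σ'.injective
    rw [← AlgEquiv.mul_apply, mul_inv_cancel, AlgEquiv.one_apply, h, ← AlgEquiv.mul_apply, mul_inv_cancel,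
      AlgEquiv.one_apply]
  apply Over.OverMorphism.ext
  have h1 : ((pointsEquivOfTower E P S).symm (pointsEquivOfTower E P S x ≫ (P.galConj E τ r).hom.hom.hom)).left =
      (pointsEquivOfTower E P S x).left ≫ P.gal E τ⁻¹ ≫ Hom.toSchemeHom r ≫ pullback.fst P.X.hom (bcSpec K E) := by
    rw [pointsEquivOfTower_symm_apply_left, bcFst_def, Over.comp_left, Category.assoc]
    change _ ≫ Hom.toSchemeHom (P.galConj E τ r) ≫ _ = _
    rw [toSchemeHom_galConj]
    simp only [Category.assoc, gal_fst]
  have h2 : (σ' • (pointsEquivOfTower E P S).symm (pointsEquivOfTower E P S (σ'⁻¹ • x) ≫ r.hom.hom.hom)).left =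
      specAut S σ' ≫ (specAut S σ'⁻¹ ≫ (pointsEquivOfTower E P S x).left ≫ P.gal E τ⁻¹) ≫
        Hom.toSchemeHom r ≫ pullback.fst P.X.hom (bcSpec K E) := by
    rw [AlgPoints.smul_left, pointsEquivOfTower_symm_apply_left, bcFst_def, Over.comp_left, Category.assoc,
      pointsEquivOfTower_smul_left E P S σ'⁻¹ τ⁻¹ h']
  rw [h1, h2]
  simp only [Category.assoc]
  rw [reassoc_of% (specAut_comp_specAut_symm S σ')]

end GalConjPoints

section GalConjTate

variable {K : Type u} [Field K] [CharZero K] (E : Type u) [Field E] [Algebra K E]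
  [Algebra (AlgebraicClosure K) (AlgebraicClosure E)] [IsScalarTower K (AlgebraicClosure K) (AlgebraicClosure E)]
  (P : AbelianVariety K) (ℓ : ℕ) [Fact ℓ.Prime]

/-- **The Galois conjugate of an endomorphism on the Tate module.** Let `σ' ∈ Aut(Ē/K)` restrict to
`τ ∈ Aut(E/K)` on `E` and be compatible with `g ∈ Γ_K` along `K̄ → Ē`; let `e : T_ℓ(P) ≃ T_ℓ(P_E)` be the
identification of brick 1 (`tateModuleBaseChangeEquivOfEmb`). Then for `r ∈ End(P_E)` and `b ∈ T_ℓ(P_E)`: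
`T_ℓ(τ • r) (e (g • e⁻¹ b)) = e (g • e⁻¹ (T_ℓ(r) b))` — i.e. `T_ℓ(τ • r) = S ∘ T_ℓ(r) ∘ S⁻¹` for the transported
Galois operator `S = e ∘ ρ_P(g) ∘ e⁻¹` (componentwise this is `(τ • r)(x) = σ' • r(σ'⁻¹ • x)` on `Ē`-points,
`pointsEquivOfTower_symm_comp_galConj`, and `(g • a)_Ē = σ' • a_Ē`, ★ `toMul_geomPointsExtend_smul`).
[cite: Milne1986AbelianVarieties, §16 (Galois descent) and proof of Thm. 12.5] [cite: Faltings1983Endlichkeit, §5, proof of Satz 4 (p. 360)] -/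
theorem tateModuleMap_galConj_apply (σ' : AlgebraicClosure E ≃ₐ[K] AlgebraicClosure E) (τ : E ≃ₐ[K] E)
    (hτ : ∀ x : E, σ' (algebraMap E (AlgebraicClosure E) x) = algebraMap E (AlgebraicClosure E) (τ x))
    (g : Field.absoluteGaloisGroup K)
    (hg : ∀ x : AlgebraicClosure K, σ' (algebraMap (AlgebraicClosure K) (AlgebraicClosure E) x) =
      algebraMap (AlgebraicClosure K) (AlgebraicClosure E) (Field.absoluteGaloisGroup.toAlgEquiv K g x))
    (r : P.baseChange E ⟶ P.baseChange E) (b : (P.baseChange E).tateModule ℓ) :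
    tateModuleMap ℓ (P.galConj E τ r)
        (P.tateModuleBaseChangeEquivOfEmb E ℓ (g • (P.tateModuleBaseChangeEquivOfEmb E ℓ).symm b)) =
      P.tateModuleBaseChangeEquivOfEmb E ℓ
        (g • (P.tateModuleBaseChangeEquivOfEmb E ℓ).symm (tateModuleMap ℓ r b)) := by
  refine TateModule.ext fun n ↦ ?_
  apply Additive.toMul.injective
  -- (g • c)_Ē read in `P_E(Ē)`: `((e (g • c))_n) = (σ' • (c_n)_Ē)_E`
  have hσ : ∀ c : P.tateModule ℓ,
      Additive.toMul (TateModule.proj ℓ n (P.tateModuleBaseChangeEquivOfEmb E ℓ (g • c)) : (P.baseChange E).geomPoints) =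
        pointsEquivOfTower E P (AlgebraicClosure E)
          (σ' • Additive.toMul (P.geomPointsExtend (AlgebraicClosure E) (TateModule.proj ℓ n c))) := fun c ↦ by
    rw [toMul_proj_tateModuleBaseChangeEquivOfEmb, TateModule.proj_smul_of_distribMulAction,
      P.toMul_geomPointsExtend_smul (AlgebraicClosure E) g σ' hg]
  -- `b_n = (y')_E` with `y' = ((e⁻¹ b)_n)_Ē`
  have hb : Additive.toMul (TateModule.proj ℓ n b : (P.baseChange E).geomPoints) =
      pointsEquivOfTower E P (AlgebraicClosure E) (Additive.toMul (P.geomPointsExtend (AlgebraicClosure E)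
        (TateModule.proj ℓ n ((P.tateModuleBaseChangeEquivOfEmb E ℓ).symm b)))) := by
    conv_lhs => rw [← (P.tateModuleBaseChangeEquivOfEmb E ℓ).apply_symm_apply b]
    rw [toMul_proj_tateModuleBaseChangeEquivOfEmb]
  -- `((e⁻¹ (T_ℓ(r) b))_n)_Ē = (y'_E ≫ r)` read back in `P(Ē)`
  have hY : Additive.toMul (P.geomPointsExtend (AlgebraicClosure E)
      (TateModule.proj ℓ n ((P.tateModuleBaseChangeEquivOfEmb E ℓ).symm (tateModuleMap ℓ r b)))) =
      (pointsEquivOfTower E P (AlgebraicClosure E)).symm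
        (pointsEquivOfTower E P (AlgebraicClosure E) (Additive.toMul (P.geomPointsExtend (AlgebraicClosure E)
          (TateModule.proj ℓ n ((P.tateModuleBaseChangeEquivOfEmb E ℓ).symm b)))) ≫ r.hom.hom.hom) := by
    apply (pointsEquivOfTower E P (AlgebraicClosure E)).injective
    rw [Equiv.apply_symm_apply, ← toMul_proj_tateModuleBaseChangeEquivOfEmb, LinearEquiv.apply_symm_apply,
      proj_tateModuleMap, Hom.geomPointsMap_apply, AlgPoints.map_apply, hb]
  -- `(τ • r)` on the point `(σ' • y')_E`
  have hL := P.pointsEquivOfTower_symm_comp_galConj E (AlgebraicClosure E) σ' τ hτ r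
    (σ' • Additive.toMul (P.geomPointsExtend (AlgebraicClosure E)
      (TateModule.proj ℓ n ((P.tateModuleBaseChangeEquivOfEmb E ℓ).symm b))))
  rw [inv_smul_smul, Equiv.symm_apply_eq] at hL
  rw [proj_tateModuleMap, Hom.geomPointsMap_apply, AlgPoints.map_apply, hσ, hL, hσ, hY]

end GalConjTate

/-! ## §3 Descent of Faltings' theorem along a finite normal extension -/

section DescentFixed

variable {K : Type u} [Field K] [CharZero K] (E : Type u) [Field E] [NumberField E] [Algebra K E]
  [Normal K E] (ℓ : ℕ) [Fact ℓ.Prime]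

/-- **The preimage under the Tate map of a `Γ_K`-equivariant operator is `Gal(E/K)`-fixed.** Let
`t ∈ ℤ_ℓ ⊗ End_E(P_E)` have Tate image `e ∘ g ∘ e⁻¹` for a `Γ_K`-equivariant `g : T_ℓ P → T_ℓ P` (with `e` the
identification `T_ℓ(P) ≃ T_ℓ(P_E)` along an embedding `K̄ → Ē`). Then `(1 ⊗ (τ • ·)) t = t` for every
`τ ∈ Aut(E/K)`: by `tateModuleMap_galConj_apply` (with `σ'` a lift of `τ` to `Ē`, Mathlib `AlgEquiv.liftNormal`,
and `g₀ = σ'|_{K̄}`) the Tate image of `(1 ⊗ (τ • ·)) t` is `S ∘ (e g e⁻¹) ∘ S⁻¹ = e g e⁻¹` (`g` commutes with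
`ρ_P(g₀)`), and the Tate map over `E` is injective (★ `faltingsTateMap_injective_holds`, Mumford §19 Thm. 3).
[cite: Faltings1983Endlichkeit, §5, proof of Satz 4 (p. 360)] [cite: Milne1986AbelianVarieties, §16 and proof of Thm. 12.5] -/
theorem lTensor_galConj_eq_of_faltingsTateMap_eq
    [Algebra (AlgebraicClosure K) (AlgebraicClosure E)] [IsScalarTower K (AlgebraicClosure K) (AlgebraicClosure E)]
    (P : AbelianVariety K) (g : tateHom P P ℓ) (t : ℤ_[ℓ] ⊗[ℤ] (P.baseChange E ⟶ P.baseChange E))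
    (ht : (faltingsTateMap (P.baseChange E) (P.baseChange E) ℓ t).toLinearMap =
      (P.tateModuleBaseChangeEquivOfEmb E ℓ : P.tateModule ℓ →ₗ[ℤ_[ℓ]] (P.baseChange E).tateModule ℓ) ∘ₗ
        g.toLinearMap ∘ₗ
          ((P.tateModuleBaseChangeEquivOfEmb E ℓ).symm : (P.baseChange E).tateModule ℓ →ₗ[ℤ_[ℓ]] P.tateModule ℓ))
    (τ : E ≃ₐ[K] E) :
    ((AddMonoidHom.mk' (P.galConj E τ) (P.galConj_add E τ) :
        (P.baseChange E ⟶ P.baseChange E) →+ (P.baseChange E ⟶ P.baseChange E)).toIntLinearMap).lTensor ℤ_[ℓ] t =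
      t := by
  haveI : IsAlgClosure K (AlgebraicClosure E) :=
    ⟨inferInstance, Algebra.IsAlgebraic.trans K E (AlgebraicClosure E)⟩
  -- a lift `σ'` of `τ` to `Ē`, and its restriction `g₀ ∈ Γ_K` along `K̄ → Ē`
  obtain ⟨σ', hτ⟩ : ∃ σ' : AlgebraicClosure E ≃ₐ[K] AlgebraicClosure E,
      ∀ x : E, σ' (algebraMap E (AlgebraicClosure E) x) = algebraMap E (AlgebraicClosure E) (τ x) :=
    ⟨τ.liftNormal (AlgebraicClosure E), fun x ↦ AlgEquiv.liftNormal_commutes τ (AlgebraicClosure E) x⟩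
  obtain ⟨g₀, hg₀⟩ : ∃ g₀ : Field.absoluteGaloisGroup K, ∀ x : AlgebraicClosure K,
      σ' (algebraMap (AlgebraicClosure K) (AlgebraicClosure E) x) =
        algebraMap (AlgebraicClosure K) (AlgebraicClosure E) (Field.absoluteGaloisGroup.toAlgEquiv K g₀ x) :=
    ⟨(Field.absoluteGaloisGroup.toAlgEquiv K).symm (σ'.restrictNormal (AlgebraicClosure K)), fun x ↦ by
      rw [MulEquiv.apply_symm_apply]
      exact (AlgEquiv.restrictNormal_commutes σ' (AlgebraicClosure K) x).symm⟩
  apply faltingsTateMap_injective_holds (P.baseChange E) (P.baseChange E) ℓ (natCast_ne_zero_of_numberField ℓ)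
  apply Representation.IntertwiningMap.ext
  -- the transported Galois operator `S b = e (g₀ • e⁻¹ b)` is onto
  have hS : Function.Surjective fun b : (P.baseChange E).tateModule ℓ ↦
      P.tateModuleBaseChangeEquivOfEmb E ℓ (g₀ • (P.tateModuleBaseChangeEquivOfEmb E ℓ).symm b) := fun b ↦
    ⟨P.tateModuleBaseChangeEquivOfEmb E ℓ (g₀⁻¹ • (P.tateModuleBaseChangeEquivOfEmb E ℓ).symm b), by
      simp only [LinearEquiv.symm_apply_apply, smul_inv_smul, LinearEquiv.apply_symm_apply]⟩
  -- Tate image of `(1 ⊗ (τ • ·)) s` on `S b`, for every `s`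
  have key : ∀ (s : ℤ_[ℓ] ⊗[ℤ] (P.baseChange E ⟶ P.baseChange E)) (b : (P.baseChange E).tateModule ℓ),
      (faltingsTateMap (P.baseChange E) (P.baseChange E) ℓ
          (((AddMonoidHom.mk' (P.galConj E τ) (P.galConj_add E τ) :
            (P.baseChange E ⟶ P.baseChange E) →+ (P.baseChange E ⟶ P.baseChange E)).toIntLinearMap).lTensor ℤ_[ℓ]
              s)).toLinearMap
          (P.tateModuleBaseChangeEquivOfEmb E ℓ (g₀ • (P.tateModuleBaseChangeEquivOfEmb E ℓ).symm b)) =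
        P.tateModuleBaseChangeEquivOfEmb E ℓ (g₀ • (P.tateModuleBaseChangeEquivOfEmb E ℓ).symm
          ((faltingsTateMap (P.baseChange E) (P.baseChange E) ℓ s).toLinearMap b)) := by
    intro s b
    induction s using TensorProduct.induction_on with
    | zero =>
      rw [map_zero, map_zero, Representation.IntertwiningMap.zero_toLinearMap, LinearMap.zero_apply,
        LinearMap.zero_apply, LinearEquiv.map_zero, smul_zero, LinearEquiv.map_zero]
    | tmul c r =>
      rw [LinearMap.lTensor_tmul, faltingsTateMap_tmul, faltingsTateMap_tmul,
        Representation.IntertwiningMap.toLinearMap_smul, Representation.IntertwiningMap.toLinearMap_smul,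
        homToTate_apply, homToTate_apply, toLinearMap_tateIntertwiningMap, toLinearMap_tateIntertwiningMap,
        LinearMap.smul_apply, LinearMap.smul_apply, AddMonoidHom.coe_toIntLinearMap, AddMonoidHom.mk'_apply,
        P.tateModuleMap_galConj_apply E ℓ σ' τ hτ g₀ hg₀ r b, LinearEquiv.map_smul, smul_comm g₀ c,
        LinearEquiv.map_smul]
    | add x y hx hy =>
      rw [map_add, map_add, map_add, Representation.IntertwiningMap.add_toLinearMap,
        Representation.IntertwiningMap.add_toLinearMap, LinearMap.add_apply, LinearMap.add_apply, hx, hy,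
        map_add, smul_add, map_add]
  refine LinearMap.ext fun b₀ ↦ ?_
  obtain ⟨b, rfl⟩ := hS b₀
  rw [key t b, ht]
  simp only [LinearMap.coe_comp, LinearEquiv.coe_coe, Function.comp_apply, LinearEquiv.symm_apply_apply]
  congr 1
  exact (Representation.IntertwiningMap.isIntertwining _ _ g g₀ _).symm

end DescentFixed

section Descent

open Literature.NumberTheory.GaloisRepresentations

variable {K : Type u} [Field K] (E : Type u) [Field E] [NumberField E] [Algebra K E]
  [FiniteDimensional K E] [Normal K E] (ℓ : ℕ) [Fact ℓ.Prime]

/-- **Faltings' isogeny theorem descends along a finite normal extension (`End` form).** For number fields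
`K ⊆ E` with `E/K` normal and an abelian variety `P` over `K`: if the Tate map
`ℤ_ℓ ⊗ End_E(P_E) → End_{Γ_E}(T_ℓ P_E)` is bijective (`faltings_tate_bijective (P.baseChange E) (P.baseChange E) ℓ`)
then so is `ℤ_ℓ ⊗ End_K(P) → End_{Γ_K}(T_ℓ P)`. Injectivity is Mumford §19 Thm. 3 over any field
(★ `faltingsTateMap_injective_holds`); for surjectivity, a `Γ_K`-equivariant `g` is transported to the
`Γ_E`-equivariant `e ∘ g ∘ e⁻¹` (`conj_tateModuleBaseChangeEquivOfEmb_smul`), its preimage `t' ∈ ℤ_ℓ ⊗ End_E(P_E)`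
is `Gal(E/K)`-fixed (`lTensor_galConj_eq_of_faltingsTateMap_eq`), hence comes from `ℤ_ℓ ⊗ End_K(P)` by flatness
of `ℤ_ℓ` and Galois descent of endomorphisms (`exists_lTensor_eq_of_forall_lTensor_eq` with ★
`exists_end_of_baseChange_eq_of_forall_smul_eq`, `galConj_baseChange`), and the Tate-map square of brick 1
(`toLinearMap_faltingsTateMap_baseChange`) identifies its image with `g`. «Wir dürfen `K` durch eine endliche
Erweiterung ersetzen.» [cite: Faltings1983Endlichkeit, §5, proof of Satz 4 (p. 360)] [cite: Milne1986AbelianVarieties, §16 and proof of Thm. 12.5] -/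
theorem faltings_tate_bijective_of_baseChange_end (P : AbelianVariety K)
    (h : faltings_tate_bijective (P.baseChange E) (P.baseChange E) ℓ) : faltings_tate_bijective P P ℓ := by
  intro _instK
  letI := absClosureAlgebra K E
  haveI := absClosure_isScalarTower K E
  refine ⟨faltingsTateMap_injective_holds P P ℓ (natCast_ne_zero_of_numberField ℓ), fun g ↦ ?_⟩
  -- the transported operator `g' = e ∘ g ∘ e⁻¹` is `Γ_E`-equivariant
  have hconj := conj_tateModuleBaseChangeEquivOfEmb_smul E ℓ (A := P) (B := P) g.toLinearMap
    (fun σ a ↦ Representation.IntertwiningMap.isIntertwining _ _ g σ a)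
  let g' : tateHom (P.baseChange E) (P.baseChange E) ℓ :=
    ((P.tateModuleBaseChangeEquivOfEmb E ℓ : P.tateModule ℓ →ₗ[ℤ_[ℓ]] (P.baseChange E).tateModule ℓ) ∘ₗ
        g.toLinearMap ∘ₗ
          ((P.tateModuleBaseChangeEquivOfEmb E ℓ).symm :
            (P.baseChange E).tateModule ℓ →ₗ[ℤ_[ℓ]] P.tateModule ℓ)).intertwiningMap_of_isIntertwiningMap _ _
      (fun σ b ↦ by
        simp only [LinearMap.coe_comp, LinearEquiv.coe_coe, Function.comp_apply, AbelianVariety.tateRep_apply_apply]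
        exact hconj σ b)
  obtain ⟨t', ht'⟩ := h.2 g'
  have ht'lin : (faltingsTateMap (P.baseChange E) (P.baseChange E) ℓ t').toLinearMap =
      (P.tateModuleBaseChangeEquivOfEmb E ℓ : P.tateModule ℓ →ₗ[ℤ_[ℓ]] (P.baseChange E).tateModule ℓ) ∘ₗ
        g.toLinearMap ∘ₗ
          ((P.tateModuleBaseChangeEquivOfEmb E ℓ).symm : (P.baseChange E).tateModule ℓ →ₗ[ℤ_[ℓ]] P.tateModule ℓ) := by
    rw [ht']
    rfl
  -- `t'` is `Gal(E/K)`-fixed, hence a base change `(1 ⊗ (·)_E) t₀`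
  obtain ⟨t₀, ht₀⟩ := exists_lTensor_eq_of_forall_lTensor_eq ℤ_[ℓ]
    ((AddMonoidHom.mk' (Hom.baseChange E) (Hom.baseChange_add E) :
      (P ⟶ P) →+ (P.baseChange E ⟶ P.baseChange E)).toIntLinearMap)
    (fun τ : E ≃ₐ[K] E ↦ (AddMonoidHom.mk' (P.galConj E τ) (P.galConj_add E τ) :
      (P.baseChange E ⟶ P.baseChange E) →+ (P.baseChange E ⟶ P.baseChange E)).toIntLinearMap)
    (fun τ f ↦ P.galConj_baseChange E τ f)
    (fun r hr ↦ by
      obtain ⟨f, hf⟩ := P.exists_end_of_baseChange_eq_of_forall_smul_eq E r fun σ ↦ hr σ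
      exact ⟨f, hf⟩)
    t' (lTensor_galConj_eq_of_faltingsTateMap_eq E ℓ P g t' ht'lin)
  refine ⟨t₀, Representation.IntertwiningMap.ext ?_⟩
  -- the Tate-map square: `e ∘ F_K(t₀) ∘ e⁻¹ = F_E((1 ⊗ (·)_E) t₀) = F_E(t') = e ∘ g ∘ e⁻¹`
  have hsq := toLinearMap_faltingsTateMap_baseChange E ℓ (A := P) (B := P) t₀
  have hbc : ((AddMonoidHom.mk' (Hom.baseChange E) (Hom.baseChange_add E) :
      (P ⟶ P) →+ (P.baseChange E ⟶ P.baseChange E)).toIntLinearMap.baseChange ℤ_[ℓ] t₀) = t' := ht₀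
  rw [hbc, ht'lin] at hsq
  refine LinearMap.ext fun a ↦ (P.tateModuleBaseChangeEquivOfEmb E ℓ).injective ?_
  have := LinearMap.congr_fun hsq (P.tateModuleBaseChangeEquivOfEmb E ℓ a)
  simp only [LinearMap.coe_comp, LinearEquiv.coe_coe, Function.comp_apply, LinearEquiv.symm_apply_apply] at this
  exact this.symm

/-- **Faltings' theorem over `E` implies Faltings' theorem over `K`** (for every pair of abelian varieties), along a
finite normal extension `E/K` of number fields: Korollar 1 for `(A, B)` over `K` follows from Satz 4 for
`(A ⊞ B)_E` over `E` (`faltings_tate_bijective_of_baseChange_end`, then ★ `faltings_tate_bijective_of_end_biprod`).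
This is the reduction «we may replace `K` by a finite extension» of [Faltings 1983, §5] (used there to assume
semistable reduction), in the form consumed by the planned stub `stub_desc`.
[cite: Faltings1983Endlichkeit, §5, proof of Satz 4 (p. 360) and Korollar 1 (p. 361)] -/
theorem faltings_tate_bijective_of_forall_baseChange
    (h : ∀ P' : AbelianVariety E, faltings_tate_bijective P' P' ℓ) (A B : AbelianVariety K) :
    faltings_tate_bijective A B ℓ :=
  faltings_tate_bijective_of_end_biprod A B ℓ
    (faltings_tate_bijective_of_baseChange_end E ℓ (A ⊞ B) (h ((A ⊞ B).baseChange E)))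

end Descent

end AbelianVariety

end Literature.AlgebraicGeometry.Motives

end
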